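import Summits.AtomisticToContinuum.FouriersLaw.Theorems.EmbeddedDrudeMourreNessUniqueTruncation

/-!
# Resolvent identification of weak flip steady states, part 2: truncation defects for the equation with a source

Helper file for crux `NoisyFourier` (stmt-AtomisticToContinuum-11977, route `VanishingNoiseTransfer`), line
`sector-dirichlet-gluing`, registered stub `stub_flipSteadyState_eq_bind_resolventKernel`. The `ε = 0` file
`EmbeddedDrudeMourreNessUniqueTruncation.lean` computes the stationary defect `L̂ f + 2γ f` of the truncations
`f = χ(H/R) m_M(ρ)` of a solution of `L̂ρ + 2γρ = 0`. Here the same is done for a `C²` solution `ρ ≥ 0` of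
`L̂ρ + cρ + g = 0` with an arbitrary constant `c` and a source `g` (for the flip steady state: `c = 2γ - Nε`,
`g = ε ∑_i ρ ∘ Θ_i`): the natural defect is `E = L̂ f + c f + χ(H/R) m_M'(ρ) g`, and

* `revGenerator_truncation_add_eq_src` — `E = a [c (m(ρ) - ρ m'(ρ)) + ½ m''(ρ) Γ(ρ,ρ)] + m(ρ) L̂ a + m'(ρ) Γ(a, ρ)`
  (`a = χ(H/R)`), i.e. the source cancels exactly against `a m'(ρ) (L̂ρ + cρ)`;
* `abs_defect_truncation_le_src` — `|E| ≤ |c| θ_M(ρ) + ½ a (-m''(ρ)) Γ(ρ,ρ) + ρ |L̂ a| + m'(ρ) |Γ(a,ρ)|`.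

No definitions.
-/

noncomputable section

open MeasureTheory ProbabilityTheory Filter Topology Set
open scoped ContDiff NNReal ENNReal

namespace Summit.AtomisticToContinuum.FouriersLaw.Theorems.NoisyFourier.FlipResolvent

open Literature.MathematicalPhysics.KineticTheory.HeatConduction
open Literature.MathematicalPhysics.KineticTheory Literature.Probability.Process OscillatorChain
open Literature.Analysis.Distribution
open Summit.AtomisticToContinuum.FouriersLaw.Theorems.SubdiffusiveBondHeat
open Summit.AtomisticToContinuum.FouriersLaw.Theorems.NessUnique

variable {N : ℕ} {P : OscillatorChain} {T_L T_R : ℝ} {ρ : PhaseSpace N → ℝ} {c : ℝ} {g : PhaseSpace N → ℝ}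

section Pointwise

variable (hU : ContDiff ℝ 2 P.U) (hV : ContDiff ℝ 2 P.V) (hρ : ContDiff ℝ 2 ρ)
  (hpde : ∀ x, sdeGenerator (fun y => -P.drift N y) (P.bathVecL N T_L) (P.bathVecR N T_R) ρ x +
    c * ρ x + g x = 0)
include hU hV hρ hpde

/-- **The defect of the truncation for the equation with a source**, pointwise: with `f = χ(H/R) m_M(ρ)`,
`a = χ(H/R)`, `m = m_M`, `m' = χ(·/M)`, `m'' = χ'(·/M)/M` and `L̂ρ + cρ + g = 0`,
`L̂ f + c f + a m'(ρ) g = a [c (m(ρ) - ρ m'(ρ)) + ½ m''(ρ) Γ(ρ,ρ)] + m(ρ) L̂ a + m'(ρ) Γ(a, ρ)`. [folklore] -/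
theorem revGenerator_truncation_add_eq_src (M R : ℝ) (x : PhaseSpace N) :
    sdeGenerator (fun y => -P.drift N y) (P.bathVecL N T_L) (P.bathVecR N T_R)
        (fun y => smoothCutoff (P.hamiltonian N y / R) * ∫ σ in (0:ℝ)..ρ y, smoothCutoff (σ / M)) x +
      c * (smoothCutoff (P.hamiltonian N x / R) * ∫ σ in (0:ℝ)..ρ x, smoothCutoff (σ / M)) +
      smoothCutoff (P.hamiltonian N x / R) * smoothCutoff (ρ x / M) * g x =
    smoothCutoff (P.hamiltonian N x / R) *
        (c * ((∫ σ in (0:ℝ)..ρ x, smoothCutoff (σ / M)) - ρ x * smoothCutoff (ρ x / M)) +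
          (1 / 2) * (deriv smoothCutoff (ρ x / M) / M) *
            carreDuChamp (P.bathVecL N T_L) (P.bathVecR N T_R) ρ ρ x) +
      (∫ σ in (0:ℝ)..ρ x, smoothCutoff (σ / M)) *
        sdeGenerator (fun y => -P.drift N y) (P.bathVecL N T_L) (P.bathVecR N T_R)
          (fun y => smoothCutoff (P.hamiltonian N y / R)) x +
      smoothCutoff (ρ x / M) *
        carreDuChamp (P.bathVecL N T_L) (P.bathVecR N T_R)
          (fun y => smoothCutoff (P.hamiltonian N y / R)) ρ x := by
  set vL := P.bathVecL N T_L
  set vR := P.bathVecR N T_R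
  set a : PhaseSpace N → ℝ := fun y => smoothCutoff (P.hamiltonian N y / R) with ha
  set m : ℝ → ℝ := fun s => ∫ σ in (0:ℝ)..s, smoothCutoff (σ / M) with hm
  have ha2 : ContDiff ℝ 2 a := contDiff_energyCutoff hU hV N R
  have hm2 : ContDiff ℝ 2 fun y => m (ρ y) := (contDiff_two_heightProfile M).comp hρ
  have hρd : Differentiable ℝ ρ := hρ.differentiable (by norm_num)
  have hprod := sdeGenerator_mul' (fun y => -P.drift N y) vL vR ha2 hm2 x
  have hcomp := sdeGenerator_comp_eq (fun y => -P.drift N y) vL vR (hasDerivAt_heightProfile M)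
    (hasDerivAt_cutoffProfile M) hρ x
  have hΓ : carreDuChamp vL vR a (fun y => m (ρ y)) x = smoothCutoff (ρ x / M) * carreDuChamp vL vR a ρ x := by
    rw [carreDuChamp_comm, carreDuChamp_comp_left vL vR (hasDerivAt_heightProfile M) hρd a x,
      carreDuChamp_comm]
  have hLρ : sdeGenerator (fun y => -P.drift N y) vL vR ρ x = -(c * ρ x) - g x := by
    have := hpde x; linarith
  show sdeGenerator (fun y => -P.drift N y) vL vR (fun y => a y * m (ρ y)) x + c * (a x * m (ρ x)) +
      a x * smoothCutoff (ρ x / M) * g x =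
    a x * (c * (m (ρ x) - ρ x * smoothCutoff (ρ x / M)) +
      (1 / 2) * (deriv smoothCutoff (ρ x / M) / M) * carreDuChamp vL vR ρ ρ x) +
    m (ρ x) * sdeGenerator (fun y => -P.drift N y) vL vR a x + smoothCutoff (ρ x / M) * carreDuChamp vL vR a ρ x
  rw [hprod, hcomp, hΓ, hLρ]
  ring

/-- **Pointwise bound on the defect**: for `ρ ≥ 0`, `M > 0`,
`|L̂ f + c f + a m'(ρ) g| ≤ |c| θ_M(ρ) + ½ a (-m''(ρ)) Γ(ρ,ρ) + ρ |L̂ a| + m'(ρ) |Γ(a,ρ)|`,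
`θ_M(s) = s [M < s]` (uses `0 ≤ a ≤ 1`, `0 ≤ m - ρ m' ≤ θ_M`, `m'' ≤ 0`, `Γ(ρ,ρ) ≥ 0`, `0 ≤ m ≤ ρ`, `m' ≥ 0`).
[folklore] -/
theorem abs_defect_truncation_le_src (hρ0 : ∀ x, 0 ≤ ρ x) {M : ℝ} (hM : 0 < M) (R : ℝ) (x : PhaseSpace N) :
    |sdeGenerator (fun y => -P.drift N y) (P.bathVecL N T_L) (P.bathVecR N T_R)
        (fun y => smoothCutoff (P.hamiltonian N y / R) * ∫ σ in (0:ℝ)..ρ y, smoothCutoff (σ / M)) x +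
      c * (smoothCutoff (P.hamiltonian N x / R) * ∫ σ in (0:ℝ)..ρ x, smoothCutoff (σ / M)) +
      smoothCutoff (P.hamiltonian N x / R) * smoothCutoff (ρ x / M) * g x| ≤
    |c| * (if M < ρ x then ρ x else 0) +
      (1 / 2) * (smoothCutoff (P.hamiltonian N x / R) * (-(deriv smoothCutoff (ρ x / M) / M) *
        carreDuChamp (P.bathVecL N T_L) (P.bathVecR N T_R) ρ ρ x)) +
      ρ x * |sdeGenerator (fun y => -P.drift N y) (P.bathVecL N T_L) (P.bathVecR N T_R)
          (fun y => smoothCutoff (P.hamiltonian N y / R)) x| +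
      smoothCutoff (ρ x / M) *
        |carreDuChamp (P.bathVecL N T_L) (P.bathVecR N T_R)
          (fun y => smoothCutoff (P.hamiltonian N y / R)) ρ x| := by
  rw [revGenerator_truncation_add_eq_src hU hV hρ hpde M R x]
  set vL := P.bathVecL N T_L
  set vR := P.bathVecR N T_R
  set ax := smoothCutoff (P.hamiltonian N x / R)
  set mx := ∫ σ in (0:ℝ)..ρ x, smoothCutoff (σ / M)
  set m1 := smoothCutoff (ρ x / M)
  set m2 := deriv smoothCutoff (ρ x / M) / M
  set Γρ := carreDuChamp vL vR ρ ρ x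
  set La := sdeGenerator (fun y => -P.drift N y) vL vR (fun y => smoothCutoff (P.hamiltonian N y / R)) x
  set Γa := carreDuChamp vL vR (fun y => smoothCutoff (P.hamiltonian N y / R)) ρ x
  have hax := energyCutoff_mem_Icc (P := P) R x
  have hmx := heightProfile_mem_Icc M (hρ0 x)
  have hm1 : 0 ≤ m1 := smoothCutoff_nonneg _
  have hm2 : m2 ≤ 0 := deriv_deriv_heightProfile_nonpos hM _
  have hΓρ : 0 ≤ Γρ := carreDuChamp_self_nonneg vL vR ρ x
  obtain ⟨-, -, hG0, hGθ⟩ := sub_heightProfile_bounds hM (hρ0 x)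
  have hG0' : 0 ≤ mx - ρ x * m1 := by simp only [mx, m1] at hG0 ⊢; linarith
  have hGθ' : mx - ρ x * m1 ≤ (if M < ρ x then ρ x else 0) := by simp only [mx, m1] at hGθ ⊢; linarith
  -- term by term
  have t1 : |ax * (c * (mx - ρ x * m1))| ≤ |c| * (if M < ρ x then ρ x else 0) := by
    rw [abs_mul, abs_mul, abs_of_nonneg hax.1, abs_of_nonneg hG0']
    calc ax * (|c| * (mx - ρ x * m1)) ≤ 1 * (|c| * (mx - ρ x * m1)) :=
          mul_le_mul_of_nonneg_right hax.2 (mul_nonneg (abs_nonneg c) hG0')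
      _ ≤ |c| * (if M < ρ x then ρ x else 0) := by
          rw [one_mul]; exact mul_le_mul_of_nonneg_left hGθ' (abs_nonneg c)
  have t2 : |ax * ((1 / 2) * m2 * Γρ)| = (1 / 2) * (ax * (-m2 * Γρ)) := by
    rw [abs_of_nonpos]
    · ring
    · have : 0 ≤ ax * (-m2 * Γρ) := mul_nonneg hax.1 (mul_nonneg (by linarith) hΓρ)
      nlinarith
  have t3 : |mx * La| ≤ ρ x * |La| := by
    rw [abs_mul, abs_of_nonneg hmx.1]
    exact mul_le_mul_of_nonneg_right hmx.2 (abs_nonneg _)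
  have t4 : |m1 * Γa| = m1 * |Γa| := by rw [abs_mul, abs_of_nonneg hm1]
  calc |ax * (c * (mx - ρ x * m1) + (1 / 2) * m2 * Γρ) + mx * La + m1 * Γa|
      ≤ |ax * (c * (mx - ρ x * m1))| + |ax * ((1 / 2) * m2 * Γρ)| + |mx * La| + |m1 * Γa| := by
        have e : ax * (c * (mx - ρ x * m1) + (1 / 2) * m2 * Γρ) + mx * La + m1 * Γa =
            ax * (c * (mx - ρ x * m1)) + ax * ((1 / 2) * m2 * Γρ) + mx * La + m1 * Γa := by ring
        rw [e]
        refine (abs_add_le _ _).trans (add_le_add ((abs_add_le _ _).trans (add_le_add ?_ le_rfl)) le_rfl)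
        exact abs_add_le _ _
    _ ≤ |c| * (if M < ρ x then ρ x else 0) + (1 / 2) * (ax * (-m2 * Γρ)) + ρ x * |La| + m1 * |Γa| := by
        rw [t2, t4]; linarith [t1, t3]

end Pointwise


/-- Registered helper (notation-free restatement of `abs_defect_truncation_le_src`). -/
theorem helper_flipTruncationDefectPointwise : ∀ (N : ℕ) (P : Literature.MathematicalPhysics.KineticTheory.HeatConduction.OscillatorChain) (T_L T_R : ℝ) (ρ : Literature.MathematicalPhysics.KineticTheory.HeatConduction.PhaseSpace N → ℝ) (c : ℝ) (g : Literature.MathematicalPhysics.KineticTheory.HeatConduction.PhaseSpace N → ℝ), ContDiff ℝ 2 P.U → ContDiff ℝ 2 P.V → ContDiff ℝ 2 ρ → (∀ x, Literature.MathematicalPhysics.KineticTheory.sdeGenerator (fun y => -P.drift N y) (P.bathVecL N T_L) (P.bathVecR N T_R) ρ x + c * ρ x + g x = 0) → (∀ x, 0 ≤ ρ x) → ∀ (M : ℝ), 0 < M → ∀ (R : ℝ) (x : Literature.MathematicalPhysics.KineticTheory.HeatConduction.PhaseSpace N), |Literature.MathematicalPhysics.KineticTheory.sdeGenerator (fun y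 => -P.drift N y) (P.bathVecL N T_L) (P.bathVecR N T_R) (fun y => Literature.MathematicalPhysics.KineticTheory.HeatConduction.smoothCutoff (P.hamiltonian N y / R) * intervalIntegral (fun σ => Literature.MathematicalPhysics.KineticTheory.HeatConduction.smoothCutoff (σ / M)) 0 (ρ y) MeasureTheory.volume) x + c * (Literature.MathematicalPhysics.KineticTheory.HeatConduction.smoothCutoff (P.hamiltonian N x / R) * intervalIntegral (fun σ => Literature.MathematicalPhysics.KineticTheory.HeatConduction.smoothCutoff (σ / M)) 0 (ρ x) MeasureTheory.volume) + Literature.MathematicalPhysics.KineticTheory.HeatConduction.smoothCutoff (P.hamiltonian N x / R) * Literature.MathematicalPhysics.KineticTheory.HeatConduction.smoothCutoff (ρ x / M) * g x| ≤ |c| * (if M < ρ x then ρ x else 0) + (1 / 2) * (Literature.MathematicalPhysics.KineticTheory.HeatConduction.smoothCutoff (P.hamiltonian N x / R) * (-(deriv Literature.MathematicalPhysics.KineticTheory.HeatConduction.smoothCutoff (ρ x / M) / M) * Literature.MathematicalPhysics.KineticTheory.carreDuChamp (P.bathVecL N T_L) (P.bathVecR N T_R) ρ ρ x)) + ρ x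 * |Literature.MathematicalPhysics.KineticTheory.sdeGenerator (fun y => -P.drift N y) (P.bathVecL N T_L) (P.bathVecR N T_R) (fun y => Literature.MathematicalPhysics.KineticTheory.HeatConduction.smoothCutoff (P.hamiltonian N y / R)) x| + Literature.MathematicalPhysics.KineticTheory.HeatConduction.smoothCutoff (ρ x / M) * |Literature.MathematicalPhysics.KineticTheory.carreDuChamp (P.bathVecL N T_L) (P.bathVecR N T_R) (fun y => Literature.MathematicalPhysics.KineticTheory.HeatConduction.smoothCutoff (P.hamiltonian N y / R)) ρ x| :=
  fun _ _ _ _ _ _ _ hU hV hρ hpde hρ0 _ hM R x => abs_defect_truncation_le_src hU hV hρ hpde hρ0 hM R x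

end Summit.AtomisticToContinuum.FouriersLaw.Theorems.NoisyFourier.FlipResolvent

end
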